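/-
Origin: expansion seat `planner-pub-hodgecm-pv09-g4-0`, handover #13 2026-08-18T08:14:47Z (`HOME/pub-hodgecm-pv09-g4/lean/Pv09g4/IdelePlaces.lean`, md5 017140b6, 144 lines);
landed by the gen-7 packager in gate run 26 as `HodgeCM/PerL34/IdelePlaces.lean` (import ^import Pv[0-9]+g[0-9]+\.→import HodgeCM.PerL34. ×1).
-/
/-
HodgeCM / PerL34 publication cell — seam S3 set-up, model side (pub-hodgecm-pv09-g4, HANDOVER #13).
WIP imports: `Pv09g4.RestrictedSumIndex` ↦ `HodgeCM.PerL34.RestrictedSumIndex` (which brings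
`HodgeCM.PerL34.RestrictedUnits`); otherwise Mathlib.  Complete proofs, no new axioms, nothing cited.
-/
import Summits.HodgeConjecture.HodgeCM.PerL34.RestrictedSumIndex

/-!
# The ideles of a number field as ONE restricted product over all places

`Place L = InfinitePlace L ⊕ HeightOneSpectrum (𝓞 L)`; `LocUnits L i` = `L_wˣ` (`w` infinite) or `L_vˣ`
(`v` finite); `intUnits L i` = `⊤` at infinite places, `𝒪_vˣ` at finite ones (compact open).  Then

  `ideleEquiv L : ideleGroup L ≃ₜ* Πʳ i : Place L, [LocUnits L i, intUnits L i]`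

(pv10's `𝔸_Lˣ = (L_∞)ˣ × (𝔸_L^∞)ˣ`, Mathlib's `(Π_w L_w)ˣ = Π_w L_wˣ`, #9 `finiteAdeleUnitsEquiv`,
#12 `topEquiv` / `sumEquiv`), with `rfl` coordinate formulas `coe_ideleEquiv_apply_inl/inr`.
This is the index shape (`ι` = places) in which the S3 end-form is stated (GAPS pv09g4-A5).
-/

set_option autoImplicit false

noncomputable section

open Topology Filter Set Sum IsDedekindDomain NumberField
open scoped RestrictedProduct

namespace HodgeCM.PerL34.IdelePlaces

/-! ## §0  `ContinuousMulEquiv` helpers -/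

section helpers

variable {M N M' N' : Type*} [MulOneClass M] [MulOneClass N] [MulOneClass M'] [MulOneClass N']
  [TopologicalSpace M] [TopologicalSpace N]
  [TopologicalSpace M'] [TopologicalSpace N']

/-- Product of two isomorphisms of topological (multiplicative) structures. -/
def prodCongr (e₁ : M ≃ₜ* M') (e₂ : N ≃ₜ* N') : M × N ≃ₜ* M' × N' :=
  { MulEquiv.prodCongr e₁.toMulEquiv e₂.toMulEquiv with
    continuous_toFun := e₁.continuous.prodMap e₂.continuous
    continuous_invFun := e₁.symm.continuous.prodMap e₂.symm.continuous }

/-- (Ported verbatim from the HodgeCMPerL package; no docstring in the source.) -/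
@[simp] theorem prodCongr_apply (e₁ : M ≃ₜ* M') (e₂ : N ≃ₜ* N') (x : M × N) :
    prodCongr e₁ e₂ x = (e₁ x.1, e₂ x.2) := rfl

end helpers

/-! ## §1  Places and local unit groups -/

variable (L : Type*) [Field L] [NumberField L]

/-- All places of `L`: infinite ⊕ finite. -/
abbrev Place : Type _ := InfinitePlace L ⊕ HeightOneSpectrum (𝓞 L)

/-- The local unit group at a place: `L_wˣ`. -/
@[reducible] def LocUnits : Place L → Type _
  | .inl w => (w.Completion)ˣ
  | .inr v => (v.adicCompletion L)ˣ

/-- (Ported verbatim from the HodgeCMPerL package; no docstring in the source.) -/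
instance instCommGroupLocUnits : ∀ i : Place L, CommGroup (LocUnits L i)
  | .inl w => inferInstanceAs (CommGroup (w.Completion)ˣ)
  | .inr v => inferInstanceAs (CommGroup (v.adicCompletion L)ˣ)

/-- (Ported verbatim from the HodgeCMPerL package; no docstring in the source.) -/
instance instTopologicalSpaceLocUnits : ∀ i : Place L, TopologicalSpace (LocUnits L i)
  | .inl w => inferInstanceAs (TopologicalSpace (w.Completion)ˣ)
  | .inr v => inferInstanceAs (TopologicalSpace (v.adicCompletion L)ˣ)

/-- (Ported verbatim from the HodgeCMPerL package; no docstring in the source.) -/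
instance instIsTopologicalGroupLocUnits : ∀ i : Place L, IsTopologicalGroup (LocUnits L i)
  | .inl w => inferInstanceAs (IsTopologicalGroup (w.Completion)ˣ)
  | .inr v => inferInstanceAs (IsTopologicalGroup (v.adicCompletion L)ˣ)

/-- The integral structure: no condition at infinite places, `𝒪_vˣ` at finite places. -/
def intUnits : ∀ i : Place L, Subgroup (LocUnits L i)
  | .inl _ => ⊤
  | .inr v => ((Submonoid.ofClass (v.adicCompletionIntegers L)).units : Subgroup (v.adicCompletion L)ˣ)

/-- (Ported verbatim from the HodgeCMPerL package; no docstring in the source.) -/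
@[simp] theorem intUnits_inl (w : InfinitePlace L) : intUnits L (inl w) = ⊤ := rfl
/-- (Ported verbatim from the HodgeCMPerL package; no docstring in the source.) -/
theorem intUnits_inr (v : HeightOneSpectrum (𝓞 L)) :
    intUnits L (inr v) = ((Submonoid.ofClass (v.adicCompletionIntegers L)).units :
      Subgroup (v.adicCompletion L)ˣ) := rfl

/-- (Ported verbatim from the HodgeCMPerL package; no docstring in the source.) -/
theorem isOpen_intUnits : ∀ i : Place L, IsOpen (intUnits L i : Set (LocUnits L i))
  | .inl _ => isOpen_univ
  | .inr v => RestrictedUnits.isOpen_units_ofClass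
      (R := fun v : HeightOneSpectrum (𝓞 L) => v.adicCompletion L)
      (B := fun v : HeightOneSpectrum (𝓞 L) => v.adicCompletionIntegers L)
      (fun _ => Valued.isOpen_valuationSubring _) v

/-- (Ported verbatim from the HodgeCMPerL package; no docstring in the source.) -/
instance fact_isOpen_intUnits : Fact (∀ i : Place L, IsOpen (intUnits L i : Set (LocUnits L i))) :=
  ⟨isOpen_intUnits L⟩

/-! ## §2  The pieces -/

/-- pv10's splitting `𝔸_Lˣ ≃ (L_∞)ˣ × (𝔸_L^∞)ˣ` as an isomorphism of topological groups. -/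
def ideleSplit : ideleGroup L ≃ₜ* (InfiniteAdeleRing L)ˣ × (FiniteAdeleRing (𝓞 L) L)ˣ :=
  { ideleGroupSplitMulEquiv L with
    continuous_toFun := (ideleGroupSplit L).continuous
    continuous_invFun := (ideleGroupSplit L).symm.continuous }

/-- `(L_∞)ˣ = Π_w L_wˣ` (Mathlib `ContinuousMulEquiv.piUnits`). -/
def infiniteUnitsEquiv : (InfiniteAdeleRing L)ˣ ≃ₜ* Π w : InfinitePlace L, (w.Completion)ˣ :=
  ContinuousMulEquiv.piUnits (M := fun w : InfinitePlace L => w.Completion)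

/-- `Π_w L_wˣ` as the unrestricted restricted product over the infinite places. -/
def infiniteUnitsEquiv' :
    (InfiniteAdeleRing L)ˣ ≃ₜ* Πʳ w : InfinitePlace L, [LocUnits L (inl w), intUnits L (inl w)] :=
  (infiniteUnitsEquiv L).trans
    (RestrictedSumIndex.topEquiv (fun w : InfinitePlace L => LocUnits L (inl w))
      (fun w => intUnits L (inl w)) (fun _ => rfl)).symm

/-- The finite part (#9). -/
def finiteUnitsEquiv' :
    (FiniteAdeleRing (𝓞 L) L)ˣ ≃ₜ* Πʳ v : HeightOneSpectrum (𝓞 L), [LocUnits L (inr v), intUnits L (inr v)] :=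
  RestrictedUnits.finiteAdeleUnitsEquiv (𝓞 L) L

/-! ## §3  The ideles over all places -/

/-- **`𝔸_Lˣ ≃ₜ* Πʳ_{all places w} [L_wˣ, 𝒪_wˣ]`** (with `𝒪_wˣ := L_wˣ` at the infinite places). -/
def ideleEquiv : ideleGroup L ≃ₜ* Πʳ i : Place L, [LocUnits L i, intUnits L i] :=
  ((ideleSplit L).trans (prodCongr (infiniteUnitsEquiv' L) (finiteUnitsEquiv' L))).trans
    (RestrictedSumIndex.sumEquiv (LocUnits L) (intUnits L)).symm

/-- Coordinate formula at an infinite place. -/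
theorem coe_ideleEquiv_apply_inl (x : ideleGroup L) (w : InfinitePlace L) :
    ((ideleEquiv L x (inl w) : (w.Completion)ˣ) : w.Completion) = (x : AdeleRing (𝓞 L) L).1 w := rfl

/-- Coordinate formula at a finite place. -/
theorem coe_ideleEquiv_apply_inr (x : ideleGroup L) (v : HeightOneSpectrum (𝓞 L)) :
    ((ideleEquiv L x (inr v) : (v.adicCompletion L)ˣ) : v.adicCompletion L) = (x : AdeleRing (𝓞 L) L).2 v := rfl

/-- Inverse-coordinate formulas. -/
theorem coe_ideleEquiv_symm_fst (y : Πʳ i : Place L, [LocUnits L i, intUnits L i]) (w : InfinitePlace L) :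
    (((ideleEquiv L).symm y : ideleGroup L) : AdeleRing (𝓞 L) L).1 w = ((y (inl w) : (w.Completion)ˣ) : w.Completion) := rfl

/-- (Ported verbatim from the HodgeCMPerL package; no docstring in the source.) -/
theorem coe_ideleEquiv_symm_snd (y : Πʳ i : Place L, [LocUnits L i, intUnits L i]) (v : HeightOneSpectrum (𝓞 L)) :
    (((ideleEquiv L).symm y : ideleGroup L) : AdeleRing (𝓞 L) L).2 v =
      ((y (inr v) : (v.adicCompletion L)ˣ) : v.adicCompletion L) := rfl

example : IsTopologicalGroup (Πʳ i : Place L, [LocUnits L i, intUnits L i]) := inferInstance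

end HodgeCM.PerL34.IdelePlaces

end
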